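import Summits.Ventures.LatticeQCDFlow.Scaling.LumpedStarPersistentLogFloor

/-!
HONEST FRAMING: exact (Metropolis-corrected) sampling algorithms for lattice gauge theory; figures
of merit are autocorrelation/cost numbers at stated couplings and volumes; no continuum-physics
claim.

# TwoContentPersistentFloor — TWO CONTENTS, ANY PERSISTENCE, ANY HUB LAW: THE LUMPED STAR'S STEP CHAIN AND ITS LAZY ∕ POOLED CHAIN OBEY
# **`t_mix(1/4) ≥ (K/((t+h)Λ) − 1)·(½·log K − log(72(1+c)²e^{2c}/Λ))`** WITH `α = min{1, W_u/W_v}`, `β = min{1, W_v/W_u}` — NO PATTERN HYPOTHESIS LEFT (lean-2 GEN-46, ours)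

Venture-side (OURS).  Cell `lqcd-flow` (pub-lqcd), unit `pub-lqcd-lean-2-g46`, 2026-08-31.  Chapter AF (the law-free `½·log K` with persistence), file 7 — file 5 specialised to a
content type `S` with exactly two elements `u ≠ v`: the pattern hypothesis of files 4–5 (`acc(u,w) = α`, `acc(w,u) = β` for `w ≠ u`) holds automatically with `α = min{1, W_u/W_v}`,
`β = min{1, W_v/W_u}` (file 4's `pair_pattern_of_persistence` with `W₂ = W_v`), so for EVERY persistence `W > 0` and EVERY hub law `μ_0 > 0` the floors of file 5 hold as displayed,
with `p = μ_0(u)`, `c̄ = pα + (1−p)β`, `D₀ = (1−σ) + σαβ/c̄`, `Λ = σ(1−σ)c̄/D₀`, `γ = σ(β−α)/D₀`, `c = σ/D₀`.  Hypothesis-equations only, no definitions.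

* **`twoContent_lazy_mixingTime_ge`** (the lazy ∕ pooled chain `S_l = tA + hB + (1−t−h)I`, `σ = t/(t+h)`), **`twoContent_step_mixingTime_ge`** (X5's step chain `S = σA + (1−σ)B`).

Reading (no numerics implied): GEN-45's two-content persistent toy (`numerics45/two_content_persistent_toy.py`) and this generation's `numerics46/pair_tmix_toy.py` (nothing claimed) are
exactly this case; with AD4 ∕ AD12 the two-content lumped star is `Θ((K/Λ)·log K)` two-sided including the logarithm for every persistence ratio and every hub law.  Literature grade
(cell rule): OWN corollary of file 5; nothing cited; no new bib keys.
-/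

noncomputable section

open Finset Function
open Literature.Probability.MarkovChains

namespace Summit.Ventures.LatticeQCDFlow.Scaling

section TwoContents
variable {X : Type*} [Fintype X] [DecidableEq X] {S : Type*} [Fintype S] [DecidableEq S]
variable {hub : X → S} {comp : X → S → ℕ} {K : ℕ} {μ0 W : S → ℝ} {σ : ℝ} {acc : S → S → ℝ} {Kh : (S → ℕ) → S → S → ℝ}
variable {Ast Bst Sst Sl : X → X → ℝ} {g : (S → ℕ) → ℝ} {πS : X → ℝ} {Z : ℝ}

/-- **TWO CONTENTS, THE LAZY ∕ POOLED CHAIN:** `S = {u, v}`, `u ≠ v`, any `W > 0`, any `μ_0 > 0`; `S_l = tA + hB + (1−t−h)I` (`0 < t`, `0 < h`, `t + h ≤ 1`), `σ = t/(t+h)` with `σ ≤ (1−σ)K`,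
`K ≥ 2`; `α = min{1, W_u/W_v}`, `β = min{1, W_v/W_u}` and the constants of file 3a at `p = μ_0(u)`:
**`t_mix^{S_l}(1/4) ≥ (K/((t+h)Λ) − 1)·(½·log K − log(72(1+c)²e^{2c}/Λ))`**. [ours] -/
theorem twoContent_lazy_mixingTime_ge [Nonempty X] (hinj : ∀ x x', hub x = hub x' → comp x = comp x' → x = x')
    (hsurj : ∀ (z : S) (N : S → ℕ), ∑ v, N v = K + 1 → N z ≠ 0 → ∃ x, hub x = z ∧ comp x = N) (hhub : ∀ x, comp x (hub x) ≠ 0)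
    (hsum : ∀ x, ∑ v, comp x v = K + 1) (hK : 2 ≤ K) (hW : ∀ v, 0 < W v) (hacc : ∀ h v, acc h v = min 1 (W h / W v)) (hμ1 : ∑ v, μ0 v = 1) (hμpos : ∀ v, 0 < μ0 v)
    {t h σ : ℝ} (ht0 : 0 < t) (hh0 : 0 < h) (hth : t + h ≤ 1) (hσ : σ = t / (t + h)) (hKσ : σ ≤ (1 - σ) * K)
    (hKoff : ∀ N h v, h ≠ v → Kh N h v = if N h = 0 then 0 else (N v : ℝ) / K * acc h v) (hKdiag : ∀ N h, Kh N h h = 1 - ∑ v ∈ univ.erase h, Kh N h v)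
    (hA : ∀ x x', Ast x x' = if comp x' = comp x then Kh (comp x) (hub x) (hub x') else 0)
    (hB : ∀ x x', Bst x x' = μ0 (hub x') * (if comp x' + Pi.single (hub x) 1 = comp x + Pi.single (hub x') 1 then 1 else 0))
    (hSl : ∀ x x', Sl x x' = t * Ast x x' + h * Bst x x' + (1 - t - h) * (if x = x' then 1 else 0))
    (hg : ∀ N, g N = ∏ v, (μ0 v * W v) ^ (N v) / ((N v).factorial : ℝ))
    (hZ : Z = ∑ x, g (comp x) * ((comp x (hub x) : ℝ) / W (hub x))) (hπS : ∀ x, πS x = g (comp x) * ((comp x (hub x) : ℝ) / W (hub x)) / Z)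
    (u v : S) (huv : u ≠ v) (htwo : ∀ w, w = u ∨ w = v)
    {cbar gs D0 Λ γ c : ℝ} (hcbar : cbar = μ0 u * min 1 (W u / W v) + (1 - μ0 u) * min 1 (W v / W u)) (hgs : gs = μ0 u * min 1 (W u / W v) / cbar)
    (hD0 : D0 = (1 - σ) + σ * min 1 (W u / W v) * min 1 (W v / W u) / cbar) (hΛ : Λ = σ * (1 - σ) * cbar / D0)
    (hγ : γ = σ * (min 1 (W v / W u) - min 1 (W u / W v)) / D0) (hc : c = σ / D0) :
    ((K : ℝ) / ((t + h) * Λ) - 1) * (Real.log K / 2 - Real.log (72 * (1 + c) ^ 2 * Real.exp (2 * c) / Λ)) ≤ (mixingTime Sl πS (1 / 4) : ℝ) := by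
  have hW2 : ∀ w, w ≠ u → W w = W v := fun w hw => by
    rcases htwo w with h1 | h1
    · exact absurd h1 hw
    · rw [h1]
  obtain ⟨hαu, hβu, hbounds⟩ := pair_pattern_of_persistence (acc := acc) (u := u) hW hacc hW2
  obtain ⟨hα0, hα1, hβ0, hβ1⟩ := hbounds v (Ne.symm huv)
  exact lumpedStar_lazy_mixingTime_ge_persistent hinj hsurj hhub hsum hK hW hacc hμ1 hμpos ht0 hh0 hth hσ hKσ hKoff hKdiag hA hB hSl hg hZ hπS u v (Ne.symm huv)
    hα0 hα1 hβ0 hβ1 hαu hβu hcbar hgs hD0 hΛ hγ hc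

/-- **TWO CONTENTS, X5's STEP CHAIN:** `S = {u, v}`, any `W > 0`, any `μ_0 > 0`, `0 < σ < 1`, `σ ≤ (1−σ)K`, `K ≥ 2`, `α = min{1, W_u/W_v}`, `β = min{1, W_v/W_u}`:
**`t_mix^{steps}(1/4) ≥ (K/Λ − 1)·(½·log K − log(72(1+c)²e^{2c}/Λ))`**. [ours] -/
theorem twoContent_step_mixingTime_ge [Nonempty X] (hinj : ∀ x x', hub x = hub x' → comp x = comp x' → x = x')
    (hsurj : ∀ (z : S) (N : S → ℕ), ∑ v, N v = K + 1 → N z ≠ 0 → ∃ x, hub x = z ∧ comp x = N) (hhub : ∀ x, comp x (hub x) ≠ 0)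
    (hsum : ∀ x, ∑ v, comp x v = K + 1) (hK : 2 ≤ K) (hW : ∀ v, 0 < W v) (hacc : ∀ h v, acc h v = min 1 (W h / W v)) (hμ1 : ∑ v, μ0 v = 1) (hμpos : ∀ v, 0 < μ0 v)
    (hσ0 : 0 < σ) (hσ1 : σ < 1) (hKσ : σ ≤ (1 - σ) * K)
    (hKoff : ∀ N h v, h ≠ v → Kh N h v = if N h = 0 then 0 else (N v : ℝ) / K * acc h v) (hKdiag : ∀ N h, Kh N h h = 1 - ∑ v ∈ univ.erase h, Kh N h v)
    (hA : ∀ x x', Ast x x' = if comp x' = comp x then Kh (comp x) (hub x) (hub x') else 0)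
    (hB : ∀ x x', Bst x x' = μ0 (hub x') * (if comp x' + Pi.single (hub x) 1 = comp x + Pi.single (hub x') 1 then 1 else 0))
    (hS : ∀ x x', Sst x x' = σ * Ast x x' + (1 - σ) * Bst x x')
    (hg : ∀ N, g N = ∏ v, (μ0 v * W v) ^ (N v) / ((N v).factorial : ℝ))
    (hZ : Z = ∑ x, g (comp x) * ((comp x (hub x) : ℝ) / W (hub x))) (hπS : ∀ x, πS x = g (comp x) * ((comp x (hub x) : ℝ) / W (hub x)) / Z)
    (u v : S) (huv : u ≠ v) (htwo : ∀ w, w = u ∨ w = v)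
    {cbar gs D0 Λ γ c : ℝ} (hcbar : cbar = μ0 u * min 1 (W u / W v) + (1 - μ0 u) * min 1 (W v / W u)) (hgs : gs = μ0 u * min 1 (W u / W v) / cbar)
    (hD0 : D0 = (1 - σ) + σ * min 1 (W u / W v) * min 1 (W v / W u) / cbar) (hΛ : Λ = σ * (1 - σ) * cbar / D0)
    (hγ : γ = σ * (min 1 (W v / W u) - min 1 (W u / W v)) / D0) (hc : c = σ / D0) :
    ((K : ℝ) / Λ - 1) * (Real.log K / 2 - Real.log (72 * (1 + c) ^ 2 * Real.exp (2 * c) / Λ)) ≤ (mixingTime Sst πS (1 / 4) : ℝ) := by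
  have hW2 : ∀ w, w ≠ u → W w = W v := fun w hw => by
    rcases htwo w with h1 | h1
    · exact absurd h1 hw
    · rw [h1]
  obtain ⟨hαu, hβu, hbounds⟩ := pair_pattern_of_persistence (acc := acc) (u := u) hW hacc hW2
  obtain ⟨hα0, hα1, hβ0, hβ1⟩ := hbounds v (Ne.symm huv)
  exact lumpedStar_step_mixingTime_ge_persistent hinj hsurj hhub hsum hK hW hacc hμ1 hμpos hσ0 hσ1 hKσ hKoff hKdiag hA hB hS hg hZ hπS u v (Ne.symm huv)
    hα0 hα1 hβ0 hβ1 hαu hβu hcbar hgs hD0 hΛ hγ hc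

end TwoContents

end Summit.Ventures.LatticeQCDFlow.Scaling

end
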